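import Literature.NumberTheory.LFunctions.WeilExplicit
import Literature.NumberTheory.LFunctions.RiemannXi
import Mathlib.Analysis.MellinTransform
import Mathlib.Analysis.SpecialFunctions.Gamma.Beta
import Literature.Analysis.SpecialFunctions.GammaVerticalBounds
import HarnessLib
import Literature.Uncategorized.GammaLowerBound

/-!
# RiemannHypothesis / SpectralTrace — definitions posited by line `hecke-cusp-perturbation-surrogate`
# of the crux `WindowTracePrime2` (stmt-RiemannHypothesis-11196)

Route `RiemannHypothesis/SpectralTrace`, crux item `WindowTracePrime2` (stmt-RiemannHypothesis-11196),
line `hecke-cusp-perturbation-surrogate` (skeleton `Cruxes/WindowTracePrime2/Lines/hecke_cusp_perturbation_surrogate.lean`,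
lead reshape r1 of 2026-08-16: registered stubs `stub_gammaLower`, `stub_horizontal`, `stub_logDerivDiff`,
`stub_zeroCount`, `stub_heckeTransfer`, `stub_windowTrace`, `stub_selection`). This file collects the
DEFINITIONS the line posits, verbatim from the checked skeleton, so that the stub proofs landing under
`Theorems/` (`--supports stmt-RiemannHypothesis-11196`) import them instead of restating them:

* `xi2` — `ξ₂ = 2ξ = s(s-1)Γ_ℝ(s)ζ(s)`, the completion of `ζ` with leading Dirichlet coefficient `1`;
* `ZIdx E`, `zval` — the zeros of an entire function counted with multiplicity (`analyticOrderNatAt`);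
* `IsSurrogate E` — a WINDOW-INVISIBLE SELF-DUAL DEGREE-ONE SURROGATE: entire, order `≤ 1` (Titchmarsh's
  quantitative shape), `E(1-s) = E(s)`, and `E = s(s-1)Γ_ℝ(s)·(1 + 2^{-s} + Σ_{k≥2} c_k ν_k^{-s})` on a
  right half-plane with all further frequencies `ν_k ≥ 3`;
* `ZeroCountBound E` — zeros in a vertical strip, local counts (with multiplicity) polynomially bounded;
* `cuspTheta`, `IsCuspDatum`, `surrogate` — Hecke's supply: real weight-`1/2` cusp data of level `9` and
  the designed object `E_φ = ξ₂ + s(s-1)·(Mellin φ)(s/2)`;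
* `GammaLowerBound`, `HorizontalLogDerivBound`, `RightHalfPlaneControl E` — the three ANALYTIC INTERFACES
  through which the window trace of a surrogate (`stub_windowTrace`) consumes the Gamma factor, the
  Landau–Titchmarsh log-derivative lemma, and the Dirichlet-series control on the right half-plane.

The only theorem is the registered stub `stub_gammaLower : Literature.Uncategorized.GammaLowerBound` (the explicit lower bound
`|Γ(1/2 + n + iy)| ≥ √π e^{-π|y|/2} 2^{-n}` from the reflection formula), which travels with this file.
References: E. Hecke, *Über die Bestimmung Dirichletscher Reihen durch ihre Funktionalgleichung*, Math. Ann.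
112 (1936) [Hecke1936]; B. C. Berndt, M. I. Knopp, *Hecke's theory of modular forms and Dirichlet series*
(2008), Thm 2.1 [BerndtKnopp2008]; E. C. Titchmarsh, *The theory of the Riemann zeta-function* (1986),
§2.12, §3.9 Lemma α, §9.2 [Titchmarsh1986]; E. Bombieri, *Remarks on Weil's quadratic functional* (2000),
Thm 2 [Bombieri2000Weil].
-/

noncomputable section

set_option linter.dupNamespace false

namespace Summit.RiemannHypothesis.RiemannHypothesis.Theorems.HeckeSurrogate

open Complex Filter Set MeasureTheory
open scoped Real Topology
open Literature.NumberTheory.LFunctions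

/-! ## The vocabulary of the line -/

/-- `ξ₂(s) := 2 ξ(s) = s(s-1) π^{-s/2} Γ(s/2) ζ(s)` — the completion of `ζ` whose Dirichlet series has
leading coefficient `1` (`riemannXi` is entire by construction; `ξ₂(0) = ξ₂(1) = 1`). [folklore] -/
def xi2 (s : ℂ) : ℂ := 2 * riemannXi s

/-- The zeros of `E` COUNTED WITH MULTIPLICITY: index `⟨ρ, k⟩` with `E ρ = 0`, `k < ord_ρ E`
(`analyticOrderNatAt`; for an entire `E ≢ 0` every zero has finite positive order). [folklore] -/
def ZIdx (E : ℂ → ℂ) : Type := Σ ρ : {s : ℂ // E s = 0}, Fin (analyticOrderNatAt E ρ.1)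

/-- The zero carried by an index. [folklore] -/
def zval {E : ℂ → ℂ} (i : ZIdx E) : ℂ := i.1.1

/-- **Window-invisible self-dual degree-one surrogate.** `E` is entire, of order at most `1` in
Titchmarsh's quantitative form (`‖E(s)‖ ≤ C exp(A‖s‖ log(1+‖s‖))`, the shape of the PROVED tree fact
`riemannXi_order_le_one_holds`), satisfies `E(1-s) = E(s)`, and on a right half-plane
`E(s) = s(s-1) Γ_ℝ(s) Σ_k c_k ν_k^{-s}` (`Γ_ℝ(s) = π^{-s/2}Γ(s/2)`, Mathlib `Complex.Gammaℝ`) with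
`c₀ = 1, ν₀ = 1, c₁ = 1, ν₁ = 2` and ALL OTHER FREQUENCIES `ν_k ≥ 3`, absolutely convergent there.
`ξ₂` is one (`c_k = 1`, `ν_k = k+1`). The interface asserts nothing about zeros.
[cite: Hecke1936, §2 (Dirichlet series with Riemann's functional equation)] -/
def IsSurrogate (E : ℂ → ℂ) : Prop :=
  Differentiable ℂ E ∧
  (∃ A C : ℝ, ∀ s : ℂ, ‖E s‖ ≤ C * Real.exp (A * ‖s‖ * Real.log (1 + ‖s‖))) ∧
  (∀ s : ℂ, E (1 - s) = E s) ∧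
  ∃ (c : ℕ → ℂ) (ν : ℕ → ℝ) (σ₀ : ℝ),
    c 0 = 1 ∧ ν 0 = 1 ∧ c 1 = 1 ∧ ν 1 = 2 ∧ (∀ k : ℕ, 2 ≤ k → 3 ≤ ν k) ∧
    Summable (fun k => ‖c k‖ * ν k ^ (-σ₀)) ∧
    ∀ s : ℂ, σ₀ < s.re →
      E s = s * (s - 1) * s.Gammaℝ * ∑' k, c k * ((ν k : ℂ) ^ (-s))

/-- **Vertical distribution of the zeros of `E`**: all zeros lie in a vertical strip
`|Re ρ - 1/2| ≤ A`, and the number of zeros with `|Im ρ - T| ≤ 1`, counted with multiplicity, is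
finite and polynomially bounded in `|T|` (the truth is `O(log(2+|T|))`; the polynomial form is all
the line uses). [cite: Titchmarsh1986, §9.2 (the shape of the local zero count)] -/
def ZeroCountBound (E : ℂ → ℂ) : Prop :=
  ∃ A : ℝ, (∀ s : ℂ, E s = 0 → |s.re - 1 / 2| ≤ A) ∧
    ∀ T : ℝ, {i : ZIdx E | |(zval i).im - T| ≤ 1}.Finite ∧
      (({i : ZIdx E | |(zval i).im - T| ≤ 1}.ncard : ℕ) : ℝ) ≤ A * (2 + |T|) ^ A

/-- The theta side of a perturbation: `φ(y) = Σ_n a_n e^{-π q_n y}` (real coefficients `a_n`,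
real exponents `q_n`; for `f ∈ M₀(λ, 1/2, 1)` with `f(τ) = Σ a_n e^{2πinτ/λ}` this is `f(iy)` with
`q_n = 2n/λ`). [cite: BerndtKnopp2008, Ch. 2 (Hecke's correspondence)] -/
def cuspTheta (a : ℕ → ℝ) (q : ℕ → ℝ) (y : ℝ) : ℂ :=
  ∑' n, (a n : ℂ) * (Real.exp (-π * q n * y) : ℂ)

/-- **Real cusp datum of level 9**: exponents `q_n ≥ 9` (so the Dirichlet frequencies `√q_n` are
`≥ 3`: WINDOW-INVISIBILITY), a polynomial-type summability `Σ |a_n| q_n^{-σ₀} < ∞`, and the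
weight-`1/2` theta relation `φ(1/y) = √y φ(y)`. `a = 0` is a datum (then `E_φ = ξ₂`).
[cite: BerndtKnopp2008, Thm 2.1 and Def 2.2] -/
def IsCuspDatum (a : ℕ → ℝ) (q : ℕ → ℝ) : Prop :=
  (∀ n : ℕ, 9 ≤ q n) ∧ (∃ σ₀ : ℝ, Summable fun n => |a n| * q n ^ (-σ₀)) ∧
    ∀ y : ℝ, 0 < y → cuspTheta a q (1 / y) = (Real.sqrt y : ℂ) * cuspTheta a q y

/-- **The designed object** `E_φ(s) := ξ₂(s) + s(s-1) · (Mellin φ)(s/2)` (Mathlib `mellin`). On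
`Re s ≫ 1`: `E_φ(s) = s(s-1) Γ_ℝ(s) (ζ(s) + Σ_n a_n q_n^{-s/2})`. [cite: Hecke1936, §2] -/
def surrogate (a : ℕ → ℝ) (q : ℕ → ℝ) (s : ℂ) : ℂ :=
  xi2 s + s * (s - 1) * mellin (cuspTheta a q) (s / 2)

/-! ## The analytic interfaces -/

/-- **Right half-plane control of a surrogate**: beyond some abscissa `σ₁ ≥ 2`, (i) the Dirichlet
series of `E` stays within `1/2` of its leading term, `|s(s-1)Γ_ℝ(s)| ≤ 2|E(s)|` (so `E ≠ 0` there,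
and by `E(1-s) = E(s)` on `Re s ≤ 1 - σ₁`), and (ii) the RELATIVE logarithmic derivative against
`ξ₂` is exponentially small with rate `log 3`: `‖E'/E(s) - ξ₂'/ξ₂(s)‖ ≤ C · 3^{-Re s}` — because
`E'/E - ξ₂'/ξ₂ = L'/L - ζ'/ζ = (L'ζ - Lζ')/(Lζ)` and in `L = 1 + 2^{-s} + A`, `ζ = 1 + 2^{-s} + B`
the frequency-`2` terms cancel: `L'ζ - Lζ' = u'(B - A) + (A' - B') + u(A' - B') + A'B - B'A`,
`u = 2^{-s}`, every term `O(3^{-σ})`. This is the WINDOW-INVISIBILITY of the perturbation in the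
form the contour argument uses (the vertical sides of the relative explicit formula vanish).
[cite: Hecke1936, §2] -/
def RightHalfPlaneControl (E : ℂ → ℂ) : Prop :=
  ∃ σ₁ C : ℝ, 2 ≤ σ₁ ∧ 0 ≤ C ∧
    (∀ s : ℂ, σ₁ ≤ s.re → ‖s * (s - 1) * s.Gammaℝ‖ ≤ 2 * ‖E s‖) ∧
    (∀ s : ℂ, σ₁ ≤ s.re → ‖logDeriv E s - logDeriv xi2 s‖ ≤ C * (3 : ℝ) ^ (-s.re))

/-! ## The registered stub `stub_gammaLower` -/

/-- On the critical line of the Gamma factor: `|Γ(1/2 + iy)| ≥ √π e^{-π|y|/2}`. [folklore] -/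
theorem norm_Gamma_half_add_ge (y : ℝ) :
    Real.sqrt π * Real.exp (-(π / 2) * |y|) ≤ ‖Complex.Gamma (1 / 2 + y * I)‖ := by
  have hsq := Literature.Analysis.SpecialFunctions.GammaVert.norm_sq_Gamma_half y
  have hcosh : (0 : ℝ) < Real.cosh (π * y) := Real.cosh_pos _
  have hcosh_le : Real.cosh (π * y) ≤ Real.exp (π * |y|) := by
    rw [Real.cosh_eq, ← abs_of_pos Real.pi_pos, ← abs_mul, abs_of_pos Real.pi_pos]
    have h1 : Real.exp (π * y) ≤ Real.exp |π * y| := Real.exp_le_exp.2 (le_abs_self _)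
    have h2 : Real.exp (-(π * y)) ≤ Real.exp |π * y| := Real.exp_le_exp.2 (neg_le_abs _)
    linarith
  -- square both sides
  have hlhs_nonneg : 0 ≤ Real.sqrt π * Real.exp (-(π / 2) * |y|) := by positivity
  rw [← abs_of_nonneg hlhs_nonneg, ← abs_of_nonneg (norm_nonneg (Complex.Gamma (1 / 2 + y * I))),
    ← sq_le_sq, hsq, mul_pow, Real.sq_sqrt Real.pi_pos.le, ← Real.exp_nat_mul]
  rw [le_div_iff₀ hcosh]
  have hexp : Real.exp ((2 : ℕ) * (-(π / 2) * |y|)) * Real.exp (π * |y|) = 1 := by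
    rw [← Real.exp_add]
    convert Real.exp_zero using 2
    push_cast
    ring
  calc π * Real.exp ((2 : ℕ) * (-(π / 2) * |y|)) * Real.cosh (π * y)
      ≤ π * Real.exp ((2 : ℕ) * (-(π / 2) * |y|)) * Real.exp (π * |y|) := by
        gcongr
    _ = π := by rw [mul_assoc, hexp, mul_one]

/-- **`stub_gammaLower`** (registered stub of the line `hecke-cusp-perturbation-surrogate`, crux
stmt-RiemannHypothesis-11196): `|Γ(1/2 + n + iy)| ≥ √π e^{-π|y|/2} 2^{-n}` for all `n : ℕ`, `y : ℝ`.
Induction on `n` with `Γ(z+1) = zΓ(z)` and `|1/2 + n + iy| ≥ 1/2`. [folklore] -/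
theorem stub_gammaLower : Literature.Uncategorized.GammaLowerBound := by
  intro n y
  induction n with
  | zero =>
    simpa using norm_Gamma_half_add_ge y
  | succ n ih =>
    have hz : (1 / 2 + (n : ℂ) + y * I) ≠ 0 := by
      intro h
      have := congrArg Complex.re h
      simp at this
      linarith [n.cast_nonneg (α := ℝ)]
    have hstep : Complex.Gamma (1 / 2 + ((n + 1 : ℕ) : ℂ) + y * I) =
        (1 / 2 + (n : ℂ) + y * I) * Complex.Gamma (1 / 2 + (n : ℂ) + y * I) := by
      rw [← Complex.Gamma_add_one _ hz]
      congr 1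
      push_cast
      ring
    rw [hstep, norm_mul]
    have hre : (1 / 2 : ℝ) ≤ ‖(1 / 2 + (n : ℂ) + y * I)‖ := by
      refine le_trans ?_ (Complex.abs_re_le_norm _)
      simp
      rw [abs_of_nonneg (by positivity)]
      linarith [n.cast_nonneg (α := ℝ)]
    have hpos : 0 ≤ Real.sqrt π * Real.exp (-(π / 2) * |y|) * (1 / 2) ^ n := by positivity
    calc Real.sqrt π * Real.exp (-(π / 2) * |y|) * (1 / 2) ^ (n + 1)
        = (1 / 2) * (Real.sqrt π * Real.exp (-(π / 2) * |y|) * (1 / 2) ^ n) := by ring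
      _ ≤ ‖(1 / 2 + (n : ℂ) + y * I)‖ * ‖Complex.Gamma (1 / 2 + (n : ℂ) + y * I)‖ :=
        mul_le_mul hre ih hpos (norm_nonneg _)

end Summit.RiemannHypothesis.RiemannHypothesis.Theorems.HeckeSurrogate

end
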